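import Literature.NumberTheory.Transcendental.ManyCurveThetaMorphic
import Literature.NumberTheory.Transcendental.ThetaTransvection
import HarnessLib

/-!
# The elementary transvections inside a class are `Θ`-morphic (family theta model)

Topic `Literature/NumberTheory/Transcendental`; unit
`provefact-Literature.NumberTheory.Transcendental.H-0a3eb64689` (fact
`Literature.NumberTheory.Transcendental.HuberWustholzManyCurvePeriods`, `ManyCurvePeriods.lean`).
It introduces NO named fact. Lattice-family counterpart of the one-lattice `ThetaTransvection.lean`:
for the theta model of `ManyCurveTheta.lean` (lattice family `L : 𝓙 → PeriodPair`, class map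
`cls : γ → 𝓙`) and two blocks `b₁ ≠ b₂` OF THE SAME CLASS (`cls b₂ = cls b₁`: both factors are
the curve `E_{cls b₁}`), the elementary transvection

  `Φ : z'_{b₁} ↦ z'_{b₁} + z'_{b₂}`  (all other coordinates fixed),  `Lie M_κ → Lie M_{κ'}`,
  `κ'_{e b₂} = κ_{e b₂} - κ_{e b₁}`  (`GaGmE.Std.tvKappa`),

is `Θ`-MORPHIC (`GaGmEFam.Std.isThetaMorphic_transvection`). Together with the sign changes and
the translations of `ManyCurveThetaMorphic.lean` this generates (Euclid, inside each class) the
transport reducing a block-diagonal abelian datum `C` to a split one. The proof is the one-lattice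
one: the generic cubic forms `GaGmE.Std.tvForm (L (cls b₁)) κ b₁ b₂ K` and the algebraic identity
`transvection_identity (L (cls b₁))` of the one-lattice file are REUSED for the common lattice of
the two active blocks; the spectator blocks `b ∉ {b₁, b₂}` enter through their own lattices
(`restP`, `restS` below); the diagonal `z'_{b₁} - z'_{b₂} ∈ Λ_{cls b₁}` is covered by composing with
translations (`isThetaMorphic_add_const`, `IsThetaMorphicAt.comp`).

Everything is PROVED; the definitions are abbreviations (`restP`, `restP'`, `restS`, `tvUnit`) and
the pointwise predicate `IsThetaMorphicAt`.

## References

* Yu. V. Nesterenko, P. Philippon (eds.), *Introduction to Algebraic Independence Theory*,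
  LNM 1752, Springer 2001, Ch. 11 (D. Roy), §2.1. [NesterenkoPhilippon2001]
* D. Bertrand, P. Philippon, *Sous-groupes algébriques de groupes algébriques commutatifs*,
  Illinois J. Math. 32 (1988), 263–280. [folklore]
* A. Huber, G. Wüstholz, *Transcendence and Linear Relations of 1-Periods*, Cambridge Tracts 227,
  CUP 2022, Thm. 15.3 (1). [HuberWustholz2022]
-/

noncomputable section

open Complex MvPolynomial
open scoped PeriodPair

namespace Literature.NumberTheory.Transcendental

namespace GaGmEFam

namespace Std

open GaGmE (Kbar)
open GaGmE.Std (iy iz is coords ThetaIdx thetaT thetaT_none rest mem_rest_iff prod_split2 sum_split2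
  prod_erase_fst prod_erase_snd prod_erase_of_mem_rest upd2 upd2_fst upd2_snd upd2_of_mem_rest prod_upd2
  upd2_self tvKappa tvMap tvMap_iz_fst tvMap_iz_of_ne tvMap_is thetaT_tvMap tvMain tvCorr₁ tvCorr₂ tvCorr₃
  tvCorr tvForm tvForm_isHomogeneous tvShift tvShift' tvMap_add_tvShift)

variable {𝓙 : Type} [DecidableEq 𝓙] {β γ δ : Type} [Fintype β] [Fintype γ] [Fintype δ] [DecidableEq γ]
variable (L : 𝓙 → PeriodPair) (cls : γ → 𝓙) (κM : δ → γ → Kbar) {b₁ b₂ : γ} (h12 : b₁ ≠ b₂)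
  (hcl : cls b₂ = cls b₁)

/-! ### Values of the theta functions: source charts `K⟨i,i'⟩`, target point -/

section Values

variable (w : β ⊕ (γ ⊕ δ) → ℂ)

/-- Abbreviation: the rest products `∏_{b ∉ {b₁,b₂}} P_{M b}(z'_b)`. [folklore] -/
def restP (M : γ → Fin 3) (w : β ⊕ (γ ⊕ δ) → ℂ) : ℂ := ∏ b ∈ rest b₁ b₂, (L (cls b)).univExtP (M b) (w (iz b))

/-- Abbreviation: rest products with one more block removed. [folklore] -/
def restP' (M : γ → Fin 3) (b : γ) (w : β ⊕ (γ ⊕ δ) → ℂ) : ℂ :=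
  ∏ b' ∈ (rest b₁ b₂).erase b, (L (cls b')).univExtP (M b') (w (iz b'))

omit [Fintype β] [Fintype δ] in
include h12 hcl in
omit [DecidableEq 𝓙] in
/-- `Θ^P_{(K⟨i,i'⟩,∅)}(w) = P_i(z₁) P_{i'}(z₂) · restP K`. [folklore] -/
theorem thetaPnone_upd2 (K : γ → Fin 3) (i i' : Fin 3) :
    thetaPnone (β := β) (δ := δ) L cls (upd2 b₁ b₂ K i i') w =
      (L (cls b₁)).univExtP i (w (iz b₁)) * (L (cls b₁)).univExtP i' (w (iz b₂)) * restP (b₁ := b₁) (b₂ := b₂) L cls K w := by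
  unfold thetaPnone restP
  have h := prod_upd2 h12 (fun b j => (L (cls b)).univExtP j (w (iz b))) K i i'
  beta_reduce at h
  rw [h, hcl]

omit [Fintype β] [Fintype δ] in
include h12 hcl in
omit [DecidableEq 𝓙] in
/-- `Θ^P_{(M,∅)}(w) = P_{M b₁}(z₁) P_{M b₂}(z₂) · restP M`. [folklore] -/
theorem thetaPnone_split (M : γ → Fin 3) :
    thetaPnone (β := β) (δ := δ) L cls M w =
      (L (cls b₁)).univExtP (M b₁) (w (iz b₁)) * (L (cls b₁)).univExtP (M b₂) (w (iz b₂)) * restP (b₁ := b₁) (b₂ := b₂) L cls M w := by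
  rw [← thetaPnone_upd2 L cls h12 hcl w M (M b₁) (M b₂), upd2_self h12]

/-- Abbreviation: the companion sum over the rest,
`∑_{b ∉ {b₁,b₂}} κ_{eb} Z_{M b}(z'_b) ∏_{b' ∉ {b₁,b₂,b}} P_{M b'}(z'_{b'})`. [folklore] -/
def restS (M : γ → Fin 3) (e : δ) (w : β ⊕ (γ ⊕ δ) → ℂ) : ℂ :=
  ∑ b ∈ rest b₁ b₂, (κM e b : ℂ) * ((L (cls b)).univExtZ (M b) (w (iz b)) * restP' (b₁ := b₁) (b₂ := b₂) L cls M b w)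

omit [Fintype β] [Fintype δ] in
include h12 hcl in
omit [DecidableEq 𝓙] in
/-- **The companion sum of `Θ^P_{(M,e)}(w)` split at `b₁, b₂`.** [folklore] -/
theorem thetaPsome_split (M : γ → Fin 3) (e : δ) :
    thetaPsome (β := β) L cls κM M e w =
      w (is e) * ((L (cls b₁)).univExtP (M b₁) (w (iz b₁)) * (L (cls b₁)).univExtP (M b₂) (w (iz b₂)) * restP (b₁ := b₁) (b₂ := b₂) L cls M w) -
      ((κM e b₁ : ℂ) * ((L (cls b₁)).univExtZ (M b₁) (w (iz b₁)) * ((L (cls b₁)).univExtP (M b₂) (w (iz b₂)) * restP (b₁ := b₁) (b₂ := b₂) L cls M w)) +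
        (κM e b₂ : ℂ) * ((L (cls b₁)).univExtZ (M b₂) (w (iz b₂)) * ((L (cls b₁)).univExtP (M b₁) (w (iz b₁)) * restP (b₁ := b₁) (b₂ := b₂) L cls M w)) +
        (L (cls b₁)).univExtP (M b₁) (w (iz b₁)) * (L (cls b₁)).univExtP (M b₂) (w (iz b₂)) * restS (b₁ := b₁) (b₂ := b₂) L cls κM M e w) := by
  have e1 : ∀ j z, (L (cls b₂)).univExtP j z = (L (cls b₁)).univExtP j z := fun j z => by rw [hcl]
  have e2 : ∀ j z, (L (cls b₂)).univExtZ j z = (L (cls b₁)).univExtZ j z := fun j z => by rw [hcl]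
  unfold thetaPsome restS restP
  rw [thetaPnone_split L cls h12 hcl w M, sum_split2 h12, Finset.mul_sum, prod_erase_fst h12,
    prod_erase_snd h12]
  unfold restP
  rw [e1, e2]
  congr 2
  refine Finset.sum_congr rfl fun b hb => ?_
  rw [prod_erase_of_mem_rest h12 _ hb]
  unfold restP'
  rw [e1]
  ring

omit [Fintype β] [Fintype δ] in
omit [DecidableEq 𝓙] in
/-- The rest products of the new point are those of the old one. [folklore] -/
theorem restP_tvMap (M : γ → Fin 3) :
    restP (b₁ := b₁) (b₂ := b₂) L cls M (tvMap b₁ b₂ w) = restP (b₁ := b₁) (b₂ := b₂) L cls M w := by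
  unfold restP
  exact Finset.prod_congr rfl fun b hb => by rw [tvMap_iz_of_ne (mem_rest_iff.mp hb).1]

omit [Fintype β] [Fintype δ] in
omit [DecidableEq 𝓙] in
/-- The same with one more block removed. [folklore] -/
theorem restP'_tvMap (M : γ → Fin 3) (b : γ) :
    restP' (b₁ := b₁) (b₂ := b₂) L cls M b (tvMap b₁ b₂ w) = restP' (b₁ := b₁) (b₂ := b₂) L cls M b w := by
  unfold restP'
  exact Finset.prod_congr rfl fun b' hb' => by
    rw [tvMap_iz_of_ne (mem_rest_iff.mp (Finset.mem_of_mem_erase hb')).1]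

omit [Fintype β] [Fintype δ] in
include h12 hcl in
omit [DecidableEq 𝓙] in
/-- **`Θ^P_{(N,∅)}` at the new point**: `P_{N b₁}(z₁ + z₂) P_{N b₂}(z₂) · restP N`. [folklore] -/
theorem thetaPnone_tvMap (N : γ → Fin 3) :
    thetaPnone (β := β) (δ := δ) L cls N (tvMap b₁ b₂ w) =
      (L (cls b₁)).univExtP (N b₁) (w (iz b₁) + w (iz b₂)) * (L (cls b₁)).univExtP (N b₂) (w (iz b₂)) * restP (b₁ := b₁) (b₂ := b₂) L cls N w := by
  rw [thetaPnone_split L cls h12 hcl _ N, restP_tvMap L cls, tvMap_iz_fst, tvMap_iz_of_ne h12.symm]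

omit [Fintype β] [Fintype δ] in
omit [DecidableEq 𝓙] in
/-- The rest companion sums of the new point are those of the old one. [folklore] -/
theorem restS_tvMap (M : γ → Fin 3) (e : δ) :
    restS (b₁ := b₁) (b₂ := b₂) L cls κM M e (tvMap b₁ b₂ w) = restS (b₁ := b₁) (b₂ := b₂) L cls κM M e w := by
  unfold restS
  exact Finset.sum_congr rfl fun b hb => by
    rw [restP'_tvMap L, tvMap_iz_of_ne (mem_rest_iff.mp hb).1]

omit [Fintype β] [Fintype δ] in
omit [DecidableEq 𝓙] in
/-- The rest companion sums do not see the change of `κ` at `b₂`. [folklore] -/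
theorem restS_tvKappa (M : γ → Fin 3) (e : δ) :
    restS (b₁ := b₁) (b₂ := b₂) L cls (tvKappa κM b₁ b₂) M e w = restS (b₁ := b₁) (b₂ := b₂) L cls κM M e w := by
  unfold restS
  exact Finset.sum_congr rfl fun b hb => by
    have hk : ((tvKappa κM b₁ b₂ e b : Kbar) : ℂ) = κM e b := by simp [tvKappa, (mem_rest_iff.mp hb).2]
    rw [hk]

omit [Fintype β] [Fintype δ] in
include h12 hcl in
omit [DecidableEq 𝓙] in
/-- **`Θ^P_{(N,e)}` at the new point, for the new `κ`.** [folklore] -/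
theorem thetaPsome_tvMap (N : γ → Fin 3) (e : δ) :
    thetaPsome (β := β) L cls (tvKappa κM b₁ b₂) N e (tvMap b₁ b₂ w) =
      w (is e) * ((L (cls b₁)).univExtP (N b₁) (w (iz b₁) + w (iz b₂)) * (L (cls b₁)).univExtP (N b₂) (w (iz b₂)) * restP (b₁ := b₁) (b₂ := b₂) L cls N w) -
      ((κM e b₁ : ℂ) * ((L (cls b₁)).univExtZ (N b₁) (w (iz b₁) + w (iz b₂)) * ((L (cls b₁)).univExtP (N b₂) (w (iz b₂)) * restP (b₁ := b₁) (b₂ := b₂) L cls N w)) +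
        ((κM e b₂ : ℂ) - (κM e b₁ : ℂ)) * ((L (cls b₁)).univExtZ (N b₂) (w (iz b₂)) *
          ((L (cls b₁)).univExtP (N b₁) (w (iz b₁) + w (iz b₂)) * restP (b₁ := b₁) (b₂ := b₂) L cls N w)) +
        (L (cls b₁)).univExtP (N b₁) (w (iz b₁) + w (iz b₂)) * (L (cls b₁)).univExtP (N b₂) (w (iz b₂)) * restS (b₁ := b₁) (b₂ := b₂) L cls κM N e w) := by
  rw [thetaPsome_split L cls (tvKappa κM b₁ b₂) h12 hcl _ N e, restP_tvMap L cls, restS_tvMap L cls _,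
    restS_tvKappa L cls κM, tvMap_iz_fst, tvMap_iz_of_ne h12.symm, tvMap_is]
  have hk1 : ((tvKappa κM b₁ b₂ e b₁ : Kbar) : ℂ) = κM e b₁ := by simp [tvKappa, h12]
  have hk2 : ((tvKappa κM b₁ b₂ e b₂ : Kbar) : ℂ) = (κM e b₂ : ℂ) - κM e b₁ := by simp [tvKappa]
  rw [hk1, hk2]

end Values




/-! ### A chart of non-vanishing blocks at a point -/

omit [Fintype β] [Fintype γ] [Fintype δ] [DecidableEq γ] in
omit [DecidableEq 𝓙] in
/-- At every point some chart has all its blocks non-zero (`2` on the lattice, `0` off it). [folklore] -/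
theorem exists_blocks_ne_zero (w : β ⊕ (γ ⊕ δ) → ℂ) :
    ∃ K : γ → Fin 3, ∀ b, (L (cls b)).univExtP (K b) (w (iz b)) ≠ 0 := by
  classical
  refine ⟨fun b => if w (iz b) ∈ (L (cls b)).lattice then 2 else 0, fun b => ?_⟩
  by_cases hb : w (iz b) ∈ (L (cls b)).lattice
  · obtain ⟨m', n', hmn⟩ := PeriodPair.mem_lattice.mp hb
    obtain ⟨c, hc, -, -, h2, -⟩ := (L (cls b)).exists_univExtTheta_lattice m' n' 0
    simp only [PeriodPair.univExtTheta_inl] at h2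
    have h2c : (if w (iz b) ∈ (L (cls b)).lattice then (2 : Fin 3) else 0) = 2 := if_pos hb
    show (L (cls b)).univExtP (if w (iz b) ∈ (L (cls b)).lattice then (2 : Fin 3) else 0) (w (iz b)) ≠ 0
    rw [h2c, ← hmn, h2]
    exact mul_ne_zero hc (by norm_num)
  · have h0 : (if w (iz b) ∈ (L (cls b)).lattice then (2 : Fin 3) else 0) = 0 := if_neg hb
    show (L (cls b)).univExtP (if w (iz b) ∈ (L (cls b)).lattice then (2 : Fin 3) else 0) (w (iz b)) ≠ 0
    rw [h0, (PeriodPair.univExtP_eq hb).1]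
    exact pow_ne_zero _ ((L (cls b)).weierstrassSigma_ne_zero hb)

/-! ### The unit of the representation -/

section Forms

variable (K : γ → Fin 3)

/-- **The unit** `u = -σ(z₁ - z₂)³ · P_{K b₁}(z₁) · (∏_{rest} P_{K b}(z_b))²`. [folklore] -/
def tvUnit (w : β ⊕ (γ ⊕ δ) → ℂ) : ℂ :=
  -((L (cls b₁)).weierstrassSigma (w (iz b₁) - w (iz b₂)) ^ 3) * (L (cls b₁)).univExtP (K b₁) (w (iz b₁)) *
    restP (b₁ := b₁) (b₂ := b₂) L cls K w ^ 2

end Forms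


/-! ### Evaluation of the forms -/

section Eval

variable (K : γ → Fin 3) (w : β ⊕ (γ ⊕ δ) → ℂ)

omit [Fintype β] [Fintype δ] in
omit [DecidableEq 𝓙] in
/-- The rest products of `M⟨i,i'⟩` are those of `M`. [folklore] -/
theorem restP_upd2 (M : γ → Fin 3) (i i' : Fin 3) :
    restP (b₁ := b₁) (b₂ := b₂) L cls (upd2 b₁ b₂ M i i') w = restP (b₁ := b₁) (b₂ := b₂) L cls M w :=
  Finset.prod_congr rfl fun b hb => by rw [upd2_of_mem_rest M i i' hb]

omit [Fintype β] [Fintype δ] in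
omit [DecidableEq 𝓙] in
/-- The same with one more block removed. [folklore] -/
theorem restP'_upd2 (M : γ → Fin 3) (i i' : Fin 3) (b : γ) :
    restP' (b₁ := b₁) (b₂ := b₂) L cls (upd2 b₁ b₂ M i i') b w = restP' (b₁ := b₁) (b₂ := b₂) L cls M b w :=
  Finset.prod_congr rfl fun b' hb' => by rw [upd2_of_mem_rest M i i' (Finset.mem_of_mem_erase hb')]

omit [Fintype β] [Fintype δ] in
omit [DecidableEq 𝓙] in
/-- The rest companion sums of `M⟨i,i'⟩` are those of `M`. [folklore] -/
theorem restS_upd2 (M : γ → Fin 3) (e : δ) (i i' : Fin 3) :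
    restS (b₁ := b₁) (b₂ := b₂) L cls κM (upd2 b₁ b₂ M i i') e w = restS (b₁ := b₁) (b₂ := b₂) L cls κM M e w :=
  Finset.sum_congr rfl fun b hb => by rw [upd2_of_mem_rest M i i' hb, restP'_upd2]

omit [Fintype β] [Fintype δ] in
include h12 hcl in
omit [DecidableEq 𝓙] in
/-- `Θ_{(a,(M⟨i,i'⟩,∅))}(w) = T_a · P_i(z₁) P_{i'}(z₂) · restP M`. [folklore] -/
theorem thetaEval_X_upd2_none (a : Option β) (M : γ → Fin 3) (i i' : Fin 3) :
    thetaEval L cls κM (X (a, (upd2 b₁ b₂ M i i', none))) w =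
      thetaT (γ := γ) (δ := δ) a w *
        ((L (cls b₁)).univExtP i (w (iz b₁)) * (L (cls b₁)).univExtP i' (w (iz b₂)) * restP (b₁ := b₁) (b₂ := b₂) L cls M w) := by
  rw [thetaEval_X, theta, thetaP_none, thetaPnone_upd2 L cls h12 hcl]

omit [Fintype β] [Fintype δ] in
include h12 hcl in
omit [DecidableEq 𝓙] in
/-- **Evaluation of the main part**: `Θ_{(a,(Ñ,o))}(w) · restP K² · A_{N b₁}(P(z₁), P(z₂))`. [folklore] -/
theorem thetaEval_tvMain (a : Option β) (N : γ → Fin 3) (o : Option δ) :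
    thetaEval L cls κM (tvMain (L (cls b₁)) b₁ b₂ K a N o) w =
      theta L cls κM (a, (upd2 b₁ b₂ N (K b₁) (N b₂), o)) w * restP (b₁ := b₁) (b₂ := b₂) L cls K w ^ 2 *
        (L (cls b₁)).chordA (N b₁) (fun j => (L (cls b₁)).univExtP j (w (iz b₁))) (fun j => (L (cls b₁)).univExtP j (w (iz b₂))) := by
  have hX : ∀ i i' : Fin 3, theta L cls κM (none, (upd2 b₁ b₂ K i i', none)) w =
      (L (cls b₁)).univExtP i (w (iz b₁)) * (L (cls b₁)).univExtP i' (w (iz b₂)) * restP (b₁ := b₁) (b₂ := b₂) L cls K w := by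
    intro i i'
    have := thetaEval_X_upd2_none L cls κM h12 hcl w none K i i'
    simpa [thetaEval] using this
  unfold tvMain
  simp only [thetaEval, map_sum, map_mul, eval_C, eval_X, hX]
  rw [PeriodPair.chordA]
  simp only [(L (cls b₁)).chordCoeff_eq_sum, Finset.sum_mul, Finset.mul_sum]
  refine Finset.sum_congr rfl fun j _ => Finset.sum_congr rfl fun k _ =>
    Finset.sum_congr rfl fun l _ => Finset.sum_congr rfl fun m _ => ?_
  ring

omit [Fintype β] [Fintype δ] in
include h12 hcl in
omit [DecidableEq 𝓙] in
/-- Values of the padded coordinates `X_{(a,(M⟨i,i'⟩,∅))}`. [folklore] -/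
theorem theta_upd2_none (a : Option β) (M : γ → Fin 3) (i i' : Fin 3) :
    theta L cls κM (a, (upd2 b₁ b₂ M i i', none)) w =
      thetaT (γ := γ) (δ := δ) a w *
        ((L (cls b₁)).univExtP i (w (iz b₁)) * (L (cls b₁)).univExtP i' (w (iz b₂)) * restP (b₁ := b₁) (b₂ := b₂) L cls M w) := by
  have := thetaEval_X_upd2_none L cls κM h12 hcl w a M i i'
  simpa [thetaEval] using this

set_option maxHeartbeats 800000 in
omit [Fintype β] [Fintype δ] in
include h12 hcl in
omit [DecidableEq 𝓙] in
/-- Evaluation of the first group. [folklore] -/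
theorem thetaEval_tvCorr₁ (a : Option β) (N : γ → Fin 3) :
    thetaEval L cls κM (tvCorr₁ (L (cls b₁)) b₁ b₂ K a N) w =
      thetaT (γ := γ) (δ := δ) a w * restP (b₁ := b₁) (b₂ := b₂) L cls N w * restP (b₁ := b₁) (b₂ := b₂) L cls K w ^ 2 *
      ((L (cls b₁)).univExtP (N b₂) (w (iz b₂)) * ∑ j : Fin 3, ∑ k : Fin 3,
          (L (cls b₁)).chordCoeff (N b₁) j k (fun j => (L (cls b₁)).univExtP j (w (iz b₂))) *
            ((L (cls b₁)).univExtP k (w (iz b₁)) * (L (cls b₁)).blockRel j (K b₁) fun l => (L (cls b₁)).univExtP l (w (iz b₁)))) := by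
  unfold tvCorr₁
  simp only [thetaEval, map_sum, map_mul, eval_C, eval_X, theta_upd2_none L cls κM h12 hcl w, thetaT_none, one_mul]
  simp only [(L (cls b₁)).chordCoeff_eq_sum, (L (cls b₁)).blockRel_eq_sum, Finset.sum_mul, Finset.mul_sum]
  refine Finset.sum_congr rfl fun j _ => Finset.sum_congr rfl fun k _ =>
    Finset.sum_congr rfl fun l _ => Finset.sum_congr rfl fun m _ =>
    Finset.sum_congr rfl fun r _ => Finset.sum_congr rfl fun t _ => ?_
  ring

set_option maxHeartbeats 800000 in
omit [Fintype β] [Fintype δ] in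
include h12 hcl in
omit [DecidableEq 𝓙] in
/-- Evaluation of the second group. [folklore] -/
theorem thetaEval_tvCorr₂ (a : Option β) (N : γ → Fin 3) :
    thetaEval L cls κM (tvCorr₂ (L (cls b₁)) b₁ b₂ K a N) w =
      thetaT (γ := γ) (δ := δ) a w * restP (b₁ := b₁) (b₂ := b₂) L cls N w * restP (b₁ := b₁) (b₂ := b₂) L cls K w ^ 2 *
      ((L (cls b₁)).univExtP (K b₁) (w (iz b₁)) * ∑ j : Fin 3, ∑ k : Fin 3,
          (L (cls b₁)).chordCoeff (N b₁) j k (fun j => (L (cls b₁)).univExtP j (w (iz b₁))) *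
            ((L (cls b₁)).univExtP k (w (iz b₂)) * (L (cls b₁)).blockRel j (N b₂) fun l => (L (cls b₁)).univExtP l (w (iz b₂)))) := by
  unfold tvCorr₂
  simp only [thetaEval, map_sum, map_mul, eval_C, eval_X, theta_upd2_none L cls κM h12 hcl w, thetaT_none, one_mul]
  simp only [(L (cls b₁)).chordCoeff_eq_sum, (L (cls b₁)).blockRel_eq_sum, Finset.sum_mul, Finset.mul_sum]
  refine Finset.sum_congr rfl fun j _ => Finset.sum_congr rfl fun k _ =>
    Finset.sum_congr rfl fun l _ => Finset.sum_congr rfl fun m _ =>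
    Finset.sum_congr rfl fun r _ => Finset.sum_congr rfl fun t _ => ?_
  ring

set_option maxHeartbeats 800000 in
omit [Fintype β] [Fintype δ] in
include h12 hcl in
omit [DecidableEq 𝓙] in
/-- Evaluation of the third group. [folklore] -/
theorem thetaEval_tvCorr₃ (a : Option β) (N : γ → Fin 3) :
    thetaEval L cls κM (tvCorr₃ (L (cls b₁)) b₁ b₂ K a N) w =
      thetaT (γ := γ) (δ := δ) a w * restP (b₁ := b₁) (b₂ := b₂) L cls N w * restP (b₁ := b₁) (b₂ := b₂) L cls K w ^ 2 *
      ((L (cls b₁)).chordC (N b₁) (fun j => (L (cls b₁)).univExtP j (w (iz b₁))) (fun j => (L (cls b₁)).univExtP j (w (iz b₂))) *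
        ((L (cls b₁)).univExtP (K b₁) (w (iz b₁)) * (L (cls b₁)).univExtP (N b₂) (w (iz b₂)))) := by
  unfold tvCorr₃
  simp only [thetaEval, map_sum, map_mul, eval_C, eval_X, theta_upd2_none L cls κM h12 hcl w, thetaT_none, one_mul]
  rw [PeriodPair.chordC_eq_sum]
  simp only [PeriodPair.chordCcoeff, Finset.sum_mul, Finset.mul_sum]
  refine Finset.sum_congr rfl fun l _ => Finset.sum_congr rfl fun m _ =>
    Finset.sum_congr rfl fun l' _ => Finset.sum_congr rfl fun m' _ => ?_
  ring

omit [Fintype β] [Fintype δ] in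
include h12 hcl in
omit [DecidableEq 𝓙] in
/-- **Evaluation of the correction**: `T_a · restP N · restP K² ·` (the pure side of
`transvection_identity`). [folklore] -/
theorem thetaEval_tvCorr (a : Option β) (N : γ → Fin 3) :
    thetaEval L cls κM (tvCorr (L (cls b₁)) b₁ b₂ K a N) w =
      thetaT (γ := γ) (δ := δ) a w * restP (b₁ := b₁) (b₂ := b₂) L cls N w * restP (b₁ := b₁) (b₂ := b₂) L cls K w ^ 2 *
      ((L (cls b₁)).univExtP (N b₂) (w (iz b₂)) * ∑ j : Fin 3, ∑ k : Fin 3,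
          (L (cls b₁)).chordCoeff (N b₁) j k (fun j => (L (cls b₁)).univExtP j (w (iz b₂))) *
            ((L (cls b₁)).univExtP k (w (iz b₁)) * (L (cls b₁)).blockRel j (K b₁) fun l => (L (cls b₁)).univExtP l (w (iz b₁))) -
        (L (cls b₁)).univExtP (K b₁) (w (iz b₁)) * ∑ j : Fin 3, ∑ k : Fin 3,
          (L (cls b₁)).chordCoeff (N b₁) j k (fun j => (L (cls b₁)).univExtP j (w (iz b₁))) *
            ((L (cls b₁)).univExtP k (w (iz b₂)) * (L (cls b₁)).blockRel j (N b₂) fun l => (L (cls b₁)).univExtP l (w (iz b₂))) -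
        (L (cls b₁)).chordC (N b₁) (fun j => (L (cls b₁)).univExtP j (w (iz b₁))) (fun j => (L (cls b₁)).univExtP j (w (iz b₂))) *
          ((L (cls b₁)).univExtP (K b₁) (w (iz b₁)) * (L (cls b₁)).univExtP (N b₂) (w (iz b₂)))) := by
  unfold tvCorr
  simp only [thetaEval, map_sub]
  change thetaEval L cls κM (tvCorr₁ (L (cls b₁)) b₁ b₂ K a N) w - thetaEval L cls κM (tvCorr₂ (L (cls b₁)) b₁ b₂ K a N) w -
    thetaEval L cls κM (tvCorr₃ (L (cls b₁)) b₁ b₂ K a N) w = _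
  rw [thetaEval_tvCorr₁ L cls κM h12 hcl, thetaEval_tvCorr₂ L cls κM h12 hcl, thetaEval_tvCorr₃ L cls κM h12 hcl]
  ring

end Eval

/-! ### The representation off the diagonal -/

section Repr

variable (K : γ → Fin 3) (w : β ⊕ (γ ⊕ δ) → ℂ)

omit [Fintype β] [Fintype δ] in
include h12 hcl in
omit [DecidableEq 𝓙] in
/-- **`tvForm` represents the transvection on the coordinates `(a,(N,∅))`.** [folklore] -/
theorem thetaEval_tvForm_none (a : Option β) (N : γ → Fin 3) :
    thetaEval L cls κM (tvForm (L (cls b₁)) κM b₁ b₂ K a N none) w =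
      tvUnit (b₁ := b₁) (b₂ := b₂) L cls K w * theta L cls (tvKappa κM b₁ b₂) (a, (N, none)) (tvMap b₁ b₂ w) := by
  simp only [tvForm]
  rw [thetaEval_tvMain L cls κM h12 hcl, theta, thetaP_none, thetaPnone_upd2 L cls h12 hcl, (L (cls b₁)).chordA_univExtP, theta,
    thetaT_tvMap, thetaP_none, thetaPnone_tvMap L cls h12 hcl, tvUnit]
  ring

set_option maxHeartbeats 800000 in
omit [Fintype β] [Fintype δ] in
include h12 hcl in
omit [DecidableEq 𝓙] in
/-- **`tvForm` represents the transvection on the fibre coordinates `(a,(N,e))`** (the heart: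
`transvection_identity`). [folklore] -/
theorem thetaEval_tvForm_some (a : Option β) (N : γ → Fin 3) (e : δ) :
    thetaEval L cls κM (tvForm (L (cls b₁)) κM b₁ b₂ K a N (some e)) w =
      tvUnit (b₁ := b₁) (b₂ := b₂) L cls K w * theta L cls (tvKappa κM b₁ b₂) (a, (N, some e)) (tvMap b₁ b₂ w) := by
  have hID := transvection_identity (L (cls b₁)) (N b₁) (K b₁) (N b₂) (w (iz b₁)) (w (iz b₂))
  have hA := (L (cls b₁)).chordA_univExtP (N b₁) (w (iz b₁)) (w (iz b₂))
  have hB := (L (cls b₁)).chord_companion (N b₁) (w (iz b₁)) (w (iz b₂))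
  simp only [tvForm]
  rw [thetaEval, map_add, map_mul, eval_C]
  change thetaEval L cls κM (tvMain (L (cls b₁)) b₁ b₂ K a N (some e)) w +
    (κM e b₁ : ℂ) * thetaEval L cls κM (tvCorr (L (cls b₁)) b₁ b₂ K a N) w = _
  rw [thetaEval_tvMain L cls κM h12 hcl, thetaEval_tvCorr L cls κM h12 hcl, theta, thetaP_some,
    thetaPsome_split L cls κM h12 hcl w _ e, upd2_fst, upd2_snd h12, restP_upd2, restS_upd2, theta, thetaT_tvMap,
    thetaP_some, thetaPsome_tvMap L cls κM h12 hcl w N e, ← hID, hA, hB, tvUnit]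
  ring

omit [Fintype β] [Fintype δ] in
include h12 hcl in
omit [DecidableEq 𝓙] in
/-- **`tvForm` represents the transvection** (all coordinates). [folklore] -/
theorem thetaEval_tvForm (J : Option β × ThetaIdx γ δ) :
    thetaEval L cls κM (tvForm (L (cls b₁)) κM b₁ b₂ K J.1 J.2.1 J.2.2) w =
      tvUnit (b₁ := b₁) (b₂ := b₂) L cls K w * theta L cls (tvKappa κM b₁ b₂) J (tvMap b₁ b₂ w) := by
  obtain ⟨a, N, _ | e⟩ := J
  · exact thetaEval_tvForm_none L cls κM h12 hcl K w a N
  · exact thetaEval_tvForm_some L cls κM h12 hcl K w a N e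

end Repr

/-! ### `Θ`-morphic at a point; the transvection is `Θ`-morphic -/

section Morphic

variable (κM' κM'' : δ → γ → Kbar)

/-- **`Θ`-morphic at the point `w₀`** (one polynomial representation good at `w₀`). [folklore] -/
def IsThetaMorphicAt (Φ : (β ⊕ (γ ⊕ δ) → ℂ) → (β ⊕ (γ ⊕ δ) → ℂ)) (w₀ : β ⊕ (γ ⊕ δ) → ℂ) : Prop :=
  ∃ (d : ℕ) (A : Option β × ThetaIdx γ δ → MvPolynomial (Option β × ThetaIdx γ δ) ℂ)
    (u : (β ⊕ (γ ⊕ δ) → ℂ) → ℂ),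
    (∀ J, (A J).IsHomogeneous d) ∧ u w₀ ≠ 0 ∧ ∀ w J, thetaEval L cls κM (A J) w = u w * theta L cls κM' J (Φ w)

omit [Fintype β] [Fintype δ] in
omit [DecidableEq 𝓙] in
/-- `Θ`-morphic means `Θ`-morphic at every point. [folklore] -/
theorem isThetaMorphic_iff (Φ : (β ⊕ (γ ⊕ δ) → ℂ) → (β ⊕ (γ ⊕ δ) → ℂ)) :
    IsThetaMorphic L cls κM κM' Φ ↔ ∀ w₀, IsThetaMorphicAt L cls κM κM' Φ w₀ := Iff.rfl

omit [Fintype β] [Fintype δ] in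
omit [DecidableEq 𝓙] in
/-- Composition at a point. [folklore] -/
theorem IsThetaMorphicAt.comp {Φ Ψ : (β ⊕ (γ ⊕ δ) → ℂ) → (β ⊕ (γ ⊕ δ) → ℂ)} {w₀ : β ⊕ (γ ⊕ δ) → ℂ}
    (hΨ : IsThetaMorphicAt L cls κM' κM'' Ψ (Φ w₀)) (hΦ : IsThetaMorphicAt L cls κM κM' Φ w₀) :
    IsThetaMorphicAt L cls κM κM'' (fun w => Ψ (Φ w)) w₀ := by
  obtain ⟨d₁, A, u, hA, hu, hAeval⟩ := hΦ
  obtain ⟨d₂, B, v, hB, hv, hBeval⟩ := hΨ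
  refine ⟨d₁ * d₂, fun J => bind₁ A (B J), fun w => u w ^ d₂ * v (Φ w), fun J => ?_,
    mul_ne_zero (pow_ne_zero _ hu) hv, fun w J => ?_⟩
  · rw [← aeval_eq_bind₁]
    exact (hB J).aeval _ hA
  · unfold thetaEval
    rw [eval_bind₁]
    have h : (fun I => eval (fun J' => theta L cls κM J' w) (A I)) = u w • fun I => theta L cls κM' I (Φ w) := by
      funext I
      exact hAeval w I
    rw [h, eval_smul_of_isHomogeneous (hB J)]
    change u w ^ d₂ * thetaEval L cls κM' (B J) (Φ w) = _
    rw [hBeval (Φ w) J, mul_assoc]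

omit [Fintype β] [Fintype δ] in
omit [DecidableEq 𝓙] in
/-- Congruence at a point. [folklore] -/
theorem IsThetaMorphicAt.congr {Φ Ψ : (β ⊕ (γ ⊕ δ) → ℂ) → (β ⊕ (γ ⊕ δ) → ℂ)} {w₀ : β ⊕ (γ ⊕ δ) → ℂ}
    (hΦ : IsThetaMorphicAt L cls κM κM' Φ w₀) (h : ∀ w, Φ w = Ψ w) : IsThetaMorphicAt L cls κM κM' Ψ w₀ := by
  have : Φ = Ψ := funext h
  subst this
  exact hΦ

omit [Fintype β] [Fintype δ] in
include h12 hcl in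
omit [DecidableEq 𝓙] in
/-- **The transvection is `Θ`-morphic at every point off the diagonal `z'_{b₁} ≡ z'_{b₂}`.** [folklore] -/
theorem isThetaMorphicAt_transvection_of_notMem {w₀ : β ⊕ (γ ⊕ δ) → ℂ}
    (hw₀ : w₀ (iz b₁) - w₀ (iz b₂) ∉ (L (cls b₁)).lattice) :
    IsThetaMorphicAt L cls κM (tvKappa κM b₁ b₂) (tvMap b₁ b₂) w₀ := by
  obtain ⟨K, hK⟩ := exists_blocks_ne_zero (β := β) (δ := δ) L cls w₀
  refine ⟨3, fun J => tvForm (L (cls b₁)) κM b₁ b₂ K J.1 J.2.1 J.2.2, tvUnit (b₁ := b₁) (b₂ := b₂) L cls K,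
    fun J => tvForm_isHomogeneous (L (cls b₁)) κM b₁ b₂ K J.1 J.2.1 J.2.2, ?_, fun w J => thetaEval_tvForm L cls κM h12 hcl K w J⟩
  refine mul_ne_zero (mul_ne_zero (neg_ne_zero.mpr (((L (cls b₁)).sigma_sub_pow_ne_zero_iff _ _).mpr hw₀)) (hK b₁))
    (pow_ne_zero _ (Finset.prod_ne_zero_iff.mpr fun b _ => hK b))

omit [Fintype β] [Fintype δ] in
include h12 hcl in
omit [DecidableEq 𝓙] in
/-- **The elementary transvection `z'_{b₁} ↦ z'_{b₁} + z'_{b₂}` is `Θ`-morphic `M_κ → M_{κ'}`**,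
`κ' = tvKappa κ b₁ b₂`. Off the diagonal by the explicit cubic forms; on the diagonal as the
composite translation – transvection at a point off the diagonal – translation.
[cite: NesterenkoPhilippon2001, Ch. 11 §2.1] -/
theorem isThetaMorphic_transvection :
    IsThetaMorphic L cls κM (tvKappa κM b₁ b₂) (tvMap b₁ b₂ : (β ⊕ (γ ⊕ δ) → ℂ) → (β ⊕ (γ ⊕ δ) → ℂ)) := by
  intro w₀
  by_cases hw₀ : w₀ (iz b₁) - w₀ (iz b₂) ∈ (L (cls b₁)).lattice
  · obtain ⟨c, hc⟩ := GaGmE.Std.exists_generic_scalar (L (cls b₁)) 2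
    have h2c : 2 * c ∉ (L (cls b₁)).lattice := by simpa using hc 1 one_pos one_lt_two
    set t := tvShift (β := β) (δ := δ) b₁ b₂ c with ht
    set t' := tvShift' (β := β) (δ := δ) b₂ c with ht'
    have hoff : (w₀ + t) (iz b₁) - (w₀ + t) (iz b₂) ∉ (L (cls b₁)).lattice := by
      intro hmem
      have heq : (w₀ + t) (iz b₁) - (w₀ + t) (iz b₂) = (w₀ (iz b₁) - w₀ (iz b₂)) + 2 * c := by
        simp [ht, tvShift, h12.symm]
        ring
      rw [heq] at hmem
      exact h2c (by simpa using (L (cls b₁)).lattice.sub_mem hmem hw₀)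
    have h1 : IsThetaMorphicAt L cls κM κM (fun w => w + t) w₀ := isThetaMorphic_add_const L cls κM t w₀
    have h2 : IsThetaMorphicAt L cls κM (tvKappa κM b₁ b₂) (tvMap b₁ b₂) (w₀ + t) :=
      isThetaMorphicAt_transvection_of_notMem L cls κM h12 hcl hoff
    have h3 : IsThetaMorphicAt L cls (tvKappa κM b₁ b₂) (tvKappa κM b₁ b₂) (fun w => w + t')
        (tvMap b₁ b₂ (w₀ + t)) := isThetaMorphic_add_const L cls (tvKappa κM b₁ b₂) t' _
    have h21 : IsThetaMorphicAt L cls κM (tvKappa κM b₁ b₂) (fun w => tvMap b₁ b₂ (w + t)) w₀ :=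
      IsThetaMorphicAt.comp L cls κM κM (tvKappa κM b₁ b₂) (Φ := fun w => w + t) (Ψ := tvMap b₁ b₂)
        (w₀ := w₀) h2 h1
    have h321 : IsThetaMorphicAt L cls κM (tvKappa κM b₁ b₂) (fun w => tvMap b₁ b₂ (w + t) + t') w₀ :=
      IsThetaMorphicAt.comp L cls κM (tvKappa κM b₁ b₂) (tvKappa κM b₁ b₂)
        (Φ := fun w => tvMap b₁ b₂ (w + t)) (Ψ := fun w => w + t') (w₀ := w₀) h3 h21
    exact h321.congr L cls _ _ fun w => tvMap_add_tvShift h12 c w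
  · exact isThetaMorphicAt_transvection_of_notMem L cls κM h12 hcl hw₀

end Morphic


end Std

end GaGmEFam

end Literature.NumberTheory.Transcendental

end
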